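import Literature.AlgebraicGeometry.AbelianSchemes.DualPairOfGluedHatRigidify
import Literature.AlgebraicGeometry.AbelianSchemes.DualPairOfGluedHatFibre
import Literature.AlgebraicGeometry.AbelianSchemes.DualPairOfGluedHatExists
import HarnessLib

/-!
# (Z3) FILE P-b ASSEMBLY: a DUAL PAIR of `A` from a glued hat with chart data (Zariski gluing of dual pairs, fields half)

Layer `Literature/AlgebraicGeometry/AbelianSchemes`, namespace `Literature.AlgebraicGeometry.AbelianSchemes.AbelianSchemeOver`.
THEOREMS ONLY; no `sorry`.  Cell hodgecm-mathlib (D-0151), FLOOR 0 P1 sub-line `Cruxes/HDel/Lines/F3DualAbelianScheme.lean` stub (Z)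
`stub_F3Z` «`DualPair`s GLUE ALONG A ZARISKI COVER OF THE BASE»; road (Z3) FILE P, half P-b (B-p06 (g14) SOCKETS
`B-provers/B-p06/g14/F3/SOCKETS-F3Z-FileP.B-p06g14.md`).  The four letters are ★-shaped sibling files: (R) `DualPairOfGluedHatRigidify`,
(F) `DualPairOfGluedHatFibre`, (U) `DualPairOfGluedHatUnique`, (E) `DualPairOfGluedHatExists`.

**`nonempty_dualPair_of_charts`** ([MumfordFogartyKirwan1994, Cor. 6.8] Zariski-locally ⇒ globally; [BoschLutkebohmertRaynaud1990, §8.1]: the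
rigidified Picard functor is a Zariski sheaf): given an abelian scheme `A → S` over a locally Noetherian `S`, an open cover `𝒰`, dual pairs `Eᵢ`
of the `Aᵢ = A ×_S Uᵢ`, an abelian scheme `H → S` with CARTESIAN charts `χᵢ : Êᵢ → H` (the glued hat — FILE H `exists_gluedHat`) and a rank-one
module `P` on `A ×_S H` whose pull-back along every product chart `Ξᵢ` is the chart Poincaré sheaf `𝒫ᵢ` (the glued Poincaré sheaf — FILE P-a
over the (Z1) engine `Modules/ModuleZariskiGluing`), the pair `(H, rigidify P)` IS a dual pair of `A`: rank one and rigidified by (R), fibrewise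
`Pic⁰` by (F), universal by (E) (existence) and (U) (uniqueness).

HC_CM is proved only modulo the 7 printed citations until rung 0 closes; this file discharges none of them (count-neutral capital).

## References
* [MumfordFogartyKirwan1994] D. Mumford, J. Fogarty, F. Kirwan, *Geometric Invariant Theory*, 3rd ed. (1994), Ch. 6 §1 Cor. 6.8 (p. 118), §2 (p. 121).
* [MilneAV2008] J. S. Milne, *Abelian Varieties* (v2.00, 2008), I §8 pp. 36–37.
* [MumfordAV1970] D. Mumford, *Abelian Varieties* (1970), §13 (p. 125).
-/

set_option autoImplicit false

-- `Scheme.Modules` / the `Over`-structure maps of ★ `baseChange` are not reducible (as in ★ `PoincareUniversalLocality`).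
set_option backward.isDefEq.respectTransparency false

noncomputable section

universe u

open CategoryTheory CategoryTheory.Limits AlgebraicGeometry MonoidalCategory
open Literature.AlgebraicGeometry.Motives Literature.AlgebraicGeometry.AbelianVarieties Literature.AlgebraicGeometry.Modules

namespace Literature.AlgebraicGeometry.AbelianSchemes

namespace AbelianSchemeOver

variable {S : Scheme.{u}} (A : AbelianSchemeOver S) (𝒰 : Scheme.OpenCover.{u} S)
  (E : ∀ i, (A.baseChange (𝒰.f i)).DualPair) (H : AbelianSchemeOver S) (χ : ∀ i, (E i).hat.X.left ⟶ H.X.left)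
  (hχ : ∀ i, (E i).hat.IsBaseChangeVia H (𝒰.f i) (χ i))

/-- **A DUAL PAIR OF `A` FROM A GLUED HAT WITH CHART DATA** ([MumfordFogartyKirwan1994, Cor. 6.8] Zariski-locally ⇒ globally): `hat := H`,
Poincaré sheaf := the re-rigidified glued module (letter (R)); `hasRank_one`, `rigid` by (R), `fibrewisePicZero` by (F), `universal` by (E)
and (U). [cite: MumfordFogartyKirwan1994, Ch. 6 §1 Cor. 6.8 (p. 118)] [cite: MilneAV2008, I §8 pp. 36–37] [cite: MumfordAV1970, §13 (p. 125)] -/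
theorem nonempty_dualPair_of_charts [IsLocallyNoetherian S] (P : (A.prodLeft H).Modules) (h1 : HasRank P 1)
    (hP : ∀ i, Nonempty ((Scheme.Modules.pullback (A.prodChart 𝒰 E H χ hχ i)).obj P ≅ (E i).P)) :
    Nonempty A.DualPair := by
  obtain ⟨P', h1', hrig, hP'⟩ := A.exists_rigidified_of_charts 𝒰 E H χ hχ P h1 hP
  refine ⟨{ hat := H
            P := P'
            hasRank_one := h1'
            rigid := hrig
            fibrewisePicZero := fun Ω _ _ b => A.isHomogeneous_fibreSlice_of_charts 𝒰 E H χ hχ P' hP' Ω b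
            universal := fun {T} f ℒ hℒ => ?_ }⟩
  obtain ⟨g, hg, hiso⟩ := A.exists_classify_of_charts 𝒰 E H χ hχ P' h1' hrig hP' f ℒ hℒ
  refine ⟨⟨g, hg⟩, hiso, fun g' hg' => Subtype.ext ?_⟩
  exact A.eq_of_nonempty_pullbackToProd_iso_of_charts 𝒰 E H χ hχ P' hP' f ℒ hℒ g'.1 g g'.2 hg hg' hiso

/-- **The same with the hat RETURNED**: the dual pair produced has `hat = H` and the chart isomorphisms along the `Ξᵢ` (for the (8δ′)
consumers that need the charts of the glued dual). [cite: MumfordFogartyKirwan1994, Ch. 6 §1 Cor. 6.8 (p. 118)] -/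
theorem exists_dualPair_hat_eq_of_charts [IsLocallyNoetherian S] (P : (A.prodLeft H).Modules) (h1 : HasRank P 1)
    (hP : ∀ i, Nonempty ((Scheme.Modules.pullback (A.prodChart 𝒰 E H χ hχ i)).obj P ≅ (E i).P)) :
    ∃ D : A.DualPair, ∃ hD : D.hat = H,
      ∀ i, Nonempty ((Scheme.Modules.pullback (A.prodChart 𝒰 E H χ hχ i)).obj (hD ▸ D.P) ≅ (E i).P) := by
  obtain ⟨P', h1', hrig, hP'⟩ := A.exists_rigidified_of_charts 𝒰 E H χ hχ P h1 hP
  refine ⟨{ hat := H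
            P := P'
            hasRank_one := h1'
            rigid := hrig
            fibrewisePicZero := fun Ω _ _ b => A.isHomogeneous_fibreSlice_of_charts 𝒰 E H χ hχ P' hP' Ω b
            universal := fun {T} f ℒ hℒ => ?_ }, rfl, hP'⟩
  obtain ⟨g, hg, hiso⟩ := A.exists_classify_of_charts 𝒰 E H χ hχ P' h1' hrig hP' f ℒ hℒ
  refine ⟨⟨g, hg⟩, hiso, fun g' hg' => Subtype.ext ?_⟩
  exact A.eq_of_nonempty_pullbackToProd_iso_of_charts 𝒰 E H χ hχ P' hP' f ℒ hℒ g'.1 g g'.2 hg hg' hiso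

end AbelianSchemeOver

end Literature.AlgebraicGeometry.AbelianSchemes

end
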